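import Summits.ResolutionOfSingularities.KangarooAtlas.MizutaniLowerBound
import Summits.ResolutionOfSingularities.KangarooAtlas.MizutaniAttained
import HarnessLib

/-!
# Mizutani's conjecture `m(e) = 2p^e − 1` holds — both halves assembled

Cell topic `Summits/ResolutionOfSingularities/KangarooAtlas` (pub-rosobs); namespace
`Summit.ResolutionOfSingularities.KangarooAtlas.Mizutani`.  The obligation node `MizutaniConjecture p e` of
`MizutaniConjecture.lean` (H. Mizutani, Nagoya Math. J. 52 (1973), Remark 2.10: "It is quite likely that
`m(e) = 2p^e − 1`"), with Oda's printed description of the invariant additive forms of a Hironaka subgroup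
scheme (Publ. RIMS 19 (1983) p. 1168) taken as the definition (`Literature/…/HironakaGroupScheme.lean`), is the
conjunction of

* the LOWER BOUND `MizutaniLowerBound p e` — encloser-2's `mizutaniLowerBound` (`MizutaniLowerBound.lean`), which
  rests on THEOREM F (`theoremF_rootTower`, `MizutaniTheoremF.lean`) and the §3 dictionary, and
* the ATTAINMENT `MizutaniAttained p e` — `mizutaniAttained` (`MizutaniAttained.lean`): the point `attP` of
  `ℙ^{2p^e−1}` over `𝔽_p(u_0, u_1)`, the LEVEL-`e` ANALOGUE OF MIZUTANI'S EXAMPLE 2.1 (invariant form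
  `Σ_{j<q} u_1^{q−1−j}(u_0 x_{0j}^q − x_{1j}^q)`, `q = p^e`; for `e = 1` it is Example 2.1 up to renaming), over a
  field of `p`-rank `2` for EVERY `e`.  It is not literally Mizutani's `H_e` of Remark 2.10, which is sketched there
  inductively from Example 2.1 with a fresh `p`-basis element per step (`p`-rank `≥ e + 1`); both have exponent `e`
  and dimension `2p^e − 1`.  Over an arbitrary field the bound is attained iff `[k : k^p] ≥ p²`
  (`mizutaniAttained_of_lt_rank`, `exponent_dichotomy`, `MizutaniAttainedGeneral.lean`).

Both are theorems of the tree for every prime `p` and every `e`; this file records the conjunction; as an EQUATION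
it is `mizutaniNumber_eq : mizutaniNumber p e = 2 * p ^ e − 1` (`MizutaniNumber.lean`; `mizutaniNumber` = the minimum
over all fields of characteristic `p` and all points, Remark 2.10 verbatim), and in Hironaka's / Mizutani's own
vocabulary (`B_{P,𝔭} = Spec S/U_+(𝔭)S`) it is `mizutani_lowerBound_hironaka` / `mizutani_attained_hironaka`
(`MizutaniHironakaSide.lean`, via Oda's equality `hirForms_eq_invForms`, PROVED in `MizutaniOdaEquality.lean`).  The whole chain
is the Lean transcription of the in-house note MIZUTANI-PROOF-g59 (AI-written, AI-audited; *AI review is weaker than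
expert review*; no human expert has refereed either the note or this transcription).  NOT a resolution-of-
singularities theorem; NOT summit progress.

References: [Mizutani1973HironakaGroupSchemes] Remark 2.10; [Oda1983HironakaGroupSchemeII] §2 (p. 1168).
-/

namespace Summit.ResolutionOfSingularities.KangarooAtlas.Mizutani

universe u

/-- **MIZUTANI'S CONJECTURE `m(e) = 2p^e − 1`** (Nagoya Math. J. 52 (1973), Remark 2.10), for every prime `p` and
every `e ≥ 0`, relative to Oda's printed description of the invariant additive forms as the definition of the
Hironaka subgroup scheme's exponent and dimension: the lower bound (`mizutaniLowerBound`) and the attainment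
(`mizutaniAttained`).  AI-written and AI-audited only; *AI review is weaker than expert review*.
[cite: Mizutani1973HironakaGroupSchemes, Remark 2.10 ("It is quite likely that m(e) = 2p^e − 1")] -/
theorem mizutaniConjecture (p : ℕ) [Fact p.Prime] (e : ℕ) : MizutaniConjecture.{u} p e :=
  mizutaniConjecture_of_attained p e (mizutaniAttained p e)

/-- **Mizutani's theorem `m(1) ≥ 2p − 1`** (Nagoya Math. J. 52 (1973), Thm. 2.8) — the named fact
`Mizutani1973_m_one` of `Literature/…/HironakaGroupScheme.lean` — recovered as the case `e = 1` of the proved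
lower bound (`mizutaniLowerBound`, `mizutaniLowerBound_one_iff`).
[cite: Mizutani1973HironakaGroupSchemes, Theorem 2.8 and Remark 2.10 ("This is in fact the case for e = 1")] -/
theorem mizutani1973_m_one (p : ℕ) [Fact p.Prime] :
    Literature.AlgebraicGeometry.Resolution.HironakaScheme.Mizutani1973_m_one.{u} p :=
  (mizutaniLowerBound_one_iff p).mp (mizutaniLowerBound p 1)

end Summit.ResolutionOfSingularities.KangarooAtlas.Mizutani
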